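import Mathlib
import Literature.Computability.Complexity.CircuitClasses
import Literature.Computability.Complexity.ConstantDepth
import Literature.Computability.Complexity.ParityQuantifier
import Literature.Computability.MetaComplexity.MCSP
import Literature.Computability.MetaComplexity.FormulaModelsAE
import HarnessLib

/-!
# Chen–Jin–Williams 2020: the sharp magnification threshold for `MCSP` against probabilistic
# De Morgan formulas — Theorems 1.3(1), 1.4(1) (thresholds) and 1.5(2), 1.6 (known lower bounds)
# as named facts (census rows R14, R15)

Citation header. L. Chen, C. Jin, R. R. Williams, *Sharp threshold results for computational
complexity*, STOC 2020, 1335–1348, doi:10.1145/3357713.3384283 [bib: `ChenJinWilliams2020`]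
(ECCC TR19-118 is the companion paper *Hardness magnification for all sparse NP languages*,
FOCS 2019). Reproduced here (typed, not proved), verbatim from the held text (§1.1, §2.1, §5.3):

* **Definition 1.1.** *"A probabilistic formula is a distribution 𝐅 over De Morgan formulas. We say 𝐅
  computes a function f, if for all x, Pr_{F∼𝐅}[F(x) = f(x)] ≥ 2/3."*
* **§2.1.** *"All logarithms are base-2. We use n to denote the number of input bits. […] We consider
  De Morgan formulas (i.e. formulas with AND, OR, NOT gates). The size of a formula F, denoted by
  L(F), is the number of leaves in F."*  **§1.1.** *"The Minimum Circuit Size Problem for size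
  parameter s(n) (MCSP[s(n)]) asks whether a given length-n truth-table has an s(n)-size circuit on
  m = log n input bits."*
* **Theorem 1.3(1).** *"If there is an ε > 0 such that for all sufficiently small α > 0, MCSP[n^α]
  does not have n^{2+ε}-size probabilistic formulas, then ⊕P ⊄ NC¹."*
* **Theorem 1.4(1).** *"For any unbounded function f(n), the following hold. 1. If there is a d > 0
  such that MCSP[(log n)^d] does not have n²(log n)^{f(n)}-size probabilistic formulas, then
  ⊕P ⊄ NC¹."*
* **Theorem 1.5(2).** *"There are c > 0, d > 0, K > 0 such that for all […] s(n) satisfying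
  (log n)^d < s(n) ≤ n/200 log n, […] 2. MCSP[s(n)] does not have probabilistic formulas of
  n^{2−K/log log n}/s(n) size."*
* **Theorem 1.6** (= Theorem 5.5: *"Let 0 < α < 1. MCSP[n^α] on input length n = 2^m does not have
  n^{2+α−ε}-size probabilistic formulas, for any ε > 0."*): *"For every α ∈ (0,1) and ε > 0, MCSP[n^α]
  doesn't have probabilistic n^{2+α−ε}-size formulas."*

Not reproduced: the `MKtP` items 1.3(2), 1.4(2), 1.5(1) (Levin's `Kt` needs an additively tight
universal machine, absent from the tree at these parameters), 1.3(3)/1.4(3) (generic sparse NP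
languages), the algorithmic §1.2, and all proofs.

## Rendering (paper `n` = our input length `N`; `m = log N` is the arity of the truth table)

* Probabilistic formulas ↦ `PFORMULAae ε S` (`FormulaModelsAE.lean`) with the error made explicit
  (referee rule F5): `ε = third := fun _ ↦ 3⁻¹` (success probability `≥ 2/3`, Definition 1.1); a
  distribution over De Morgan formulas each of leaf size `≤ S N` (support-wise bound — the standard
  reading, cf. Remark 1.2), required at all sufficiently large lengths `N`, deciding `L` at every
  length. So `L ∉ PFORMULAae third S` says: every such family fails at infinitely many lengths — the
  content the source proves (Theorem 5.2 / Theorem 5.5 are per-input-length statements for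
  `n = 2^m`, every large `m`) and the meaning of "does not have S-size probabilistic formulas".
  For the THRESHOLDS this reading of the hypothesis is at least as strong as either textbook
  reading of "does not have" (fails at some length / at infinitely many lengths), so Theorems
  1.3(1)/1.4(1) are rendered weaker-or-equal under both; for the KNOWN BOUNDS it is exactly what the
  per-length Theorems 5.2 and 5.5 give.
* De Morgan formulas ↦ tree formulas over `deMorganBasis` (fan-in-2 `∧, ∨`, and `¬` gates anywhere),
  size `Circuit.leafSize` = number of input-gate occurrences (leaves), Definition §2.1. Pushing
  negations to the leaves does not change the leaf count, so the two formula notions have the same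
  size-`S` classes; a constant function costs `2` leaves here (`x ∧ ¬x`), immaterial since every
  bound below is `≥ 2` at all large `N`.
* `MCSP[s(n)]` ↦ `MCSPSize s'` (`MCSP.lean`: truth tables, in the tree's `Fin`-order, of `m`-ary
  functions of `B₂`-circuit complexity `≤ s' m`), with `s' m = s(2^m)` re-indexed by arity:
  `MCSP[n^α] ↦ MCSPSize (fun m ↦ ⌊2^{αm}⌋₊)` (`Size ≤ n^α ↔ Size ≤ ⌊n^α⌋`, exact) and
  `MCSP[(log n)^d] ↦ MCSPSize (fun m ↦ m^d)` with `d : ℕ` (the thresholds only need SOME `d`; an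
  integer one is a special case, so the rendered implication is weaker). The source does not fix a
  gate basis for "circuit" (§2.2); we read it, as Oliveira–Pich–Santhanam (ToC 2021, §1.2) do
  explicitly, as fan-in-two circuits over `B₂` counted by gates. The four statements are insensitive
  to the choice of a complete fan-in-2 basis up to the unnamed constants (`d`, and the slack in
  `200`): the threshold proofs use only the sparsity of `MCSP[small s]` and a `⊕P` verifier, the
  lower-bound proofs (Theorems 5.2, 5.5) only that hitting-set strings have `polylog`-size circuits
  and that random strings have near-maximal circuit complexity.
* Size bounds. THRESHOLDS (paper class ⊆ ours ⇒ our hypothesis implies the paper's):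
  `n^{2+ε} ↦ ⌈N^{2+ε}⌉₊` leaves; `n²(log n)^{f(n)} ↦ N² ⌈log₂ N⌉^{f N}` (`Nat.clog`, `≥ log₂ N`, and
  equal to it at the lengths `N = 2^m` where `MCSP` lives); "any unbounded f" ↦ any `f : ℕ → ℕ` with
  `f → ∞` (a sub-family of the unbounded functions ⇒ weaker). KNOWN BOUNDS (our class ⊆ paper's ⇒
  implied by the printed bound): `n^{2+α−ε} ↦ ⌊N^{2+α−ε}⌋₊`, `n^{2−K/log log n}/s(n) ↦
  ⌊N^{2−K/log₂log₂N}/s'(⌊log₂ N⌋)⌋₊` with `K d : ℕ` (rounding the source's positive reals up only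
  shrinks our class / strengthens the side condition), the side condition
  `(log n)^d < s(n) ≤ n/(200 log n)` imposed at all large `m` (it is unsatisfiable at small `n`, so
  "for all n" can only mean eventually; and `MCSPSize s'` depends on each value of `s'` at one length
  only, where `FamilyAE.congr_eventually` makes finitely many lengths immaterial).
* `⊕P ⊄ NC¹` ↦ `¬ (ParityP ⊆ NC1)` with the tree's `ParityP` (`⊕·P`) and non-uniform `NC1`
  (`ConstantDepth.lean`: polynomial size, depth `O(log n)`, `B₂` gates — contained in the textbook
  non-uniform `NC¹`, so a `⊕P` language outside the latter is outside ours).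

Locality barrier (census column): CHOPRS (J. ACM 2022, arXiv:1911.08297), Theorem 1 / §1.3: the
lower-bound techniques behind Theorems 1.5–1.6 (random restrictions, hitting sets, `#SAT`-based
shrinkage) extend to formulas with small-fan-in oracle gates at the bottom, whereas the magnification
theorems 1.3/1.4 are proved by constructing exactly such oracle formulas (CJW §1.3, "we construct
such an oracle circuit directly"); the a.e.-formula analogue of CHOPRS's frontier `B4/C4` is typed
in `MagnificationFrontiersAE.lean`.

The R15 gap made checkable: `powLowerBound_of_thm16` — Theorem 1.6 proves the hypothesis of
Theorem 1.3(1) for every FIXED `α > ε` (`n^{2+α−ε'} ≥ n^{2+ε}`), while Theorem 1.3(1) needs it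
for ALL sufficiently small `α`; numerically the exponents `2 + α − o(1)` (known) and `2 + ε` (needed,
`α → 0`) differ by an arbitrarily small constant — CJW's "sharp threshold".
-/

noncomputable section

namespace Literature.Computability.MetaComplexity.ChenJinWilliams2020

open scoped ENNReal
open Filter Literature.Computability.Complexity Literature.Computability.MetaComplexity

/-- The error bound of Definition 1.1: success probability `≥ 2/3`, i.e. error `≤ 1/3`, at every
length. [cite: ChenJinWilliams2020, Def. 1.1] -/
def third : ℕ → ℝ≥0∞ := fun _ => 3⁻¹

/-- `MCSP[n^α]`: truth tables (length `N = 2^m`) of `m`-ary functions with a `B₂`-circuit of at most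
`⌊N^α⌋ = ⌊2^{αm}⌋` gates. [cite: ChenJinWilliams2020, §1.1 (MCSP[s(n)])] -/
def powMCSP (α : ℝ) : Language Bool := MCSPSize fun m => ⌊(2 : ℝ) ^ (α * m)⌋₊

/-- `MCSP[(log n)^d]` for an integer exponent `d`: circuit complexity `≤ m^d = (log₂ N)^d`.
[cite: ChenJinWilliams2020, §1.1 (MCSP[s(n)])] -/
def polylogMCSP (d : ℕ) : Language Bool := MCSPSize fun m => m ^ d

/-- The threshold size bound `n^{2+ε}` of Theorem 1.3, in leaves, rounded up.
[cite: ChenJinWilliams2020, Thm. 1.3 (parameters)] -/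
def thresholdBound13 (ε : ℝ) (N : ℕ) : ℕ := ⌈(N : ℝ) ^ (2 + ε)⌉₊

/-- The threshold size bound `n²(log n)^{f(n)}` of Theorem 1.4, in leaves, with `⌈log₂ N⌉`.
[cite: ChenJinWilliams2020, Thm. 1.4 (parameters)] -/
def thresholdBound14 (f : ℕ → ℕ) (N : ℕ) : ℕ := N ^ 2 * Nat.clog 2 N ^ f N

/-- The known bound `n^{2+α−ε}` of Theorem 1.6, in leaves, rounded down.
[cite: ChenJinWilliams2020, Thm. 1.6 (parameters)] -/
def knownBound16 (α ε : ℝ) (N : ℕ) : ℕ := ⌊(N : ℝ) ^ (2 + α - ε)⌋₊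

/-- The known bound `n^{2−K/log log n}/s(n)` of Theorem 1.5(2), in leaves, rounded down, with the
size parameter re-indexed by arity (`s' ⌊log₂ N⌋ = s(N)` at `N = 2^m`).
[cite: ChenJinWilliams2020, Thm. 1.5 (parameters)] -/
def knownBound15 (K : ℕ) (s : ℕ → ℕ) (N : ℕ) : ℕ :=
  ⌊(N : ℝ) ^ (2 - (K : ℝ) / Real.logb 2 (Real.logb 2 N)) / (s (Nat.log 2 N) : ℝ)⌋₊

/-! ### Thresholds (magnification theorems) -/

/-- **`MCSP[n^α]` does not have `n^{2+ε}`-size probabilistic formulas** (one instance of the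
hypothesis of Theorem 1.3(1)): no distribution over De Morgan formulas of eventually at most
`⌈N^{2+ε}⌉` leaves computes `MCSP[n^α]` with error `≤ 1/3` at all large lengths. Known (Theorem 1.6,
`powLowerBound_of_thm16`) for each fixed `α ∈ (ε, 1)`; OPEN uniformly for all small `α`.
[cite: ChenJinWilliams2020, Thm. 1.3 (hypothesis)] -/
def PowLowerBound (α ε : ℝ) : Prop := powMCSP α ∉ PFORMULAae third (thresholdBound13 ε)

/-- **The hypothesis of Theorem 1.3(1)**: *"there is an ε > 0 such that for all sufficiently small
α > 0, MCSP[n^α] does not have n^{2+ε}-size probabilistic formulas"*. OPEN (census row R15: the gap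
to Theorem 1.6 is the order of quantifiers `∀ small α` versus `fixed α > ε`).
[cite: ChenJinWilliams2020, Thm. 1.3 (hypothesis)] -/
def Hypothesis13 : Prop :=
  ∃ ε : ℝ, 0 < ε ∧ ∃ α₀ : ℝ, 0 < α₀ ∧ ∀ α : ℝ, 0 < α → α < α₀ → PowLowerBound α ε

/-- **Chen–Jin–Williams, Theorem 1.3(1)** as a named fact: *"If there is an ε > 0 such that for all
sufficiently small α > 0, MCSP[n^α] does not have n^{2+ε}-size probabilistic formulas, then
⊕P ⊄ NC¹."* Rendering: module docstring (a.e. probabilistic De Morgan leaf-size classes with error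
`1/3`, `MCSP` over `B₂`, `⌈N^{2+ε}⌉` leaves, `¬ (ParityP ⊆ NC1)`), each choice weaker-or-equal.
Proof in the source: §5.1 (from Theorem 4.1, a `2^{O(n)}·poly`-time `#SAT` algorithm for
`n^{2−ε}`-size probabilistic formulas with `⊕P`-oracle leaves). Users take `(h : thm13_1)`.
[cite: ChenJinWilliams2020, Thm. 1.3(1)] -/
def thm13_1 : Prop := Hypothesis13 → ¬ (ParityP ⊆ NC1)

/-- **`MCSP[(log n)^d]` does not have `n²(log n)^{f(n)}`-size probabilistic formulas** (the
hypothesis of Theorem 1.4(1) for given `f`, `d`). OPEN for every unbounded `f` and every `d` (census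
row R14: Theorem 1.5(2) gives `n^{2−K/log log n}/(log n)^d`, a factor `(log n)^{f(n)+d}·n^{o(1)}`
below). [cite: ChenJinWilliams2020, Thm. 1.4 (hypothesis)] -/
def PolylogLowerBound (f : ℕ → ℕ) (d : ℕ) : Prop :=
  polylogMCSP d ∉ PFORMULAae third (thresholdBound14 f)

/-- **The hypothesis of Theorem 1.4(1) for the unbounded function `f`**: *"there is a d > 0 such
that MCSP[(log n)^d] does not have n²(log n)^{f(n)}-size probabilistic formulas"* (integer `d`).
[cite: ChenJinWilliams2020, Thm. 1.4 (hypothesis)] -/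
def Hypothesis14 (f : ℕ → ℕ) : Prop := ∃ d : ℕ, 0 < d ∧ PolylogLowerBound f d

/-- **Chen–Jin–Williams, Theorem 1.4(1)** as a named fact: *"For any unbounded function f(n) […]
If there is a d > 0 such that MCSP[(log n)^d] does not have n²(log n)^{f(n)}-size probabilistic
formulas, then ⊕P ⊄ NC¹."* Rendering: module docstring (`f : ℕ → ℕ` tending to infinity, integer
`d`, `N²⌈log₂N⌉^{f N}` leaves, error `1/3`, `¬ (ParityP ⊆ NC1)`), each choice weaker-or-equal.
Proof in the source: §5.1. Users take `(h : thm14_1)`. [cite: ChenJinWilliams2020, Thm. 1.4(1)] -/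
def thm14_1 : Prop :=
  ∀ f : ℕ → ℕ, Tendsto f atTop atTop → Hypothesis14 f → ¬ (ParityP ⊆ NC1)

/-! ### Known lower bounds -/

/-- **Chen–Jin–Williams, Theorem 1.5(2)** as a named fact: *"There are c > 0, d > 0, K > 0 such
that for all […] s(n) satisfying (log n)^d < s(n) ≤ n/200 log n, […] MCSP[s(n)] does not have
probabilistic formulas of n^{2−K/log log n}/s(n) size."* Rendering: module docstring (integer
`d, K`; size parameter indexed by arity, side condition at all large arities; `⌊·⌋` leaves; error
`1/3`), each choice weaker-or-equal. Proof in the source: §5.2 (Theorem 5.2, hitting sets from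
Theorem 3.2, and the `#SAT` algorithm of Theorem 4.1 without oracles). Users take `(h : thm15_2)`.
[cite: ChenJinWilliams2020, Thm. 1.5(2)] -/
def thm15_2 : Prop :=
  ∃ d K : ℕ, ∀ s : ℕ → ℕ,
    (∃ m₀ : ℕ, ∀ m : ℕ, m₀ ≤ m → m ^ d < s m ∧ 200 * m * s m ≤ 2 ^ m) →
      MCSPSize s ∉ PFORMULAae third (knownBound15 K s)

/-- **Chen–Jin–Williams, Theorem 1.6 (= Theorem 5.5)** as a named fact: *"For every α ∈ (0,1) and
ε > 0, MCSP[n^α] doesn't have probabilistic n^{2+α−ε}-size formulas."* Rendering: module docstring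
(`MCSP[n^α]` over `B₂` with `⌊2^{αm}⌋` gates, `⌊N^{2+α−ε}⌋` leaves, error `1/3`, a.e. class),
each choice weaker-or-equal. Proof in the source: §5.3 (adapting [CKLM19]). Users take
`(h : thm16)`. [cite: ChenJinWilliams2020, Thm. 1.6] -/
def thm16 : Prop :=
  ∀ α ε : ℝ, 0 < α → α < 1 → 0 < ε → powMCSP α ∉ PFORMULAae third (knownBound16 α ε)

/-! ### API: consequence shapes and the typed R15 gap -/

/-- Consequence shape of Theorem 1.3(1). [cite: ChenJinWilliams2020, Thm. 1.3(1)] -/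
theorem parityP_not_subset_NC1_of_hypothesis13 (h : thm13_1) (hlb : Hypothesis13) :
    ¬ (ParityP ⊆ NC1) := h hlb

/-- Consequence shape of Theorem 1.4(1): one unbounded `f` and one `d` suffice.
[cite: ChenJinWilliams2020, Thm. 1.4(1)] -/
theorem parityP_not_subset_NC1_of_polylogLowerBound (h : thm14_1) {f : ℕ → ℕ}
    (hf : Tendsto f atTop atTop) {d : ℕ} (hd : 0 < d) (hlb : PolylogLowerBound f d) :
    ¬ (ParityP ⊆ NC1) := h f hf ⟨d, hd, hlb⟩

/-- Real-analysis helper: for exponents `0 ≤ a < b`, eventually `⌈N^a⌉ ≤ ⌊N^b⌋`. [folklore] -/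
theorem eventually_ceil_rpow_le_floor_rpow {a b : ℝ} (ha : 0 ≤ a) (hab : a < b) :
    ∃ N₀ : ℕ, ∀ N : ℕ, N₀ ≤ N → ⌈(N : ℝ) ^ a⌉₊ ≤ ⌊(N : ℝ) ^ b⌋₊ := by
  have hδ : 0 < b - a := sub_pos.mpr hab
  refine ⟨⌈(2 : ℝ) ^ (1 / (b - a))⌉₊ + 1, fun N hN => ?_⟩
  have hN1 : (1 : ℝ) ≤ N := by
    have : 1 ≤ N := le_trans (Nat.le_add_left 1 _) hN
    exact_mod_cast this
  have hN0 : (0 : ℝ) < N := lt_of_lt_of_le one_pos hN1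
  -- `N ≥ 2^{1/(b-a)}`, hence `N^{b-a} ≥ 2`
  have hNge : (2 : ℝ) ^ (1 / (b - a)) ≤ N := by
    have h1 : (2 : ℝ) ^ (1 / (b - a)) ≤ ⌈(2 : ℝ) ^ (1 / (b - a))⌉₊ := Nat.le_ceil _
    have h2 : (⌈(2 : ℝ) ^ (1 / (b - a))⌉₊ : ℝ) ≤ N := by
      have : ⌈(2 : ℝ) ^ (1 / (b - a))⌉₊ ≤ N := le_trans (Nat.le_succ _) hN
      exact_mod_cast this
    exact h1.trans h2
  have hpow2 : (2 : ℝ) ≤ (N : ℝ) ^ (b - a) := by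
    have h := Real.rpow_le_rpow (by positivity) hNge hδ.le
    have h' : ((2 : ℝ) ^ (1 / (b - a))) ^ (b - a) = 2 := by
      rw [← Real.rpow_mul (by norm_num : (0 : ℝ) ≤ 2), one_div_mul_cancel hδ.ne', Real.rpow_one]
    rw [h'] at h
    exact h
  have ha1 : (1 : ℝ) ≤ (N : ℝ) ^ a := Real.one_le_rpow hN1 ha
  -- `N^b = N^a · N^{b-a} ≥ 2 N^a ≥ N^a + 1`
  have hb : (N : ℝ) ^ a + 1 ≤ (N : ℝ) ^ b := by
    have : (N : ℝ) ^ b = (N : ℝ) ^ a * (N : ℝ) ^ (b - a) := by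
      rw [← Real.rpow_add hN0]; ring_nf
    rw [this]
    nlinarith
  -- conclude with `⌈x⌉ ≤ ⌊y⌋` from `x + 1 ≤ y`
  refine Nat.ceil_le.mpr ?_
  have hlt : (N : ℝ) ^ b - 1 < ⌊(N : ℝ) ^ b⌋₊ := Nat.sub_one_lt_floor _
  linarith

/-- **The R15 gap, typed.** Theorem 1.6 yields the hypothesis of Theorem 1.3(1) for every FIXED
`α ∈ (ε, 1)` (take `ε' = (α − ε)/2`, so `n^{2+α−ε'}` eventually exceeds `⌈n^{2+ε}⌉`, and use
monotonicity of the a.e. class); Theorem 1.3(1) asks for it for ALL sufficiently small `α`, which no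
known bound provides. [cite: ChenJinWilliams2020, Thms. 1.3(1), 1.6 (comparison, §1.1)] -/
theorem powLowerBound_of_thm16 (h : thm16) {α ε : ℝ} (hε : 0 < ε) (hεα : ε < α) (hα1 : α < 1) :
    PowLowerBound α ε := by
  intro hmem
  have hα : 0 < α := hε.trans hεα
  set ε' : ℝ := (α - ε) / 2 with hε'
  have hε'pos : 0 < ε' := by rw [hε']; linarith
  -- eventually `⌈N^{2+ε}⌉ ≤ ⌊N^{2+α-ε'}⌋`
  obtain ⟨N₀, hN₀⟩ := eventually_ceil_rpow_le_floor_rpow (a := 2 + ε) (b := 2 + α - ε')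
    (by linarith) (by rw [hε']; linarith)
  have hsub : PFORMULAae third (thresholdBound13 ε) ⊆ PFORMULAae third (knownBound16 α ε') :=
    PFORMULAae_mono (fun _ => le_rfl) ⟨N₀, fun N hN => hN₀ N hN⟩
  exact h α ε' hα hα1 hε'pos (hsub hmem)

end Literature.Computability.MetaComplexity.ChenJinWilliams2020
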